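/-
Copyright (c) 2026 the pub-hodgecm-mathlib formalisation cell (harness21).  Prover seat hodgecm-mathlib-K2E1-p10 (g2), Track B ∕ K2-LIT (build stream 29),
h413 = `stmt-HodgeConjecture-24833`, route of record `HCCMUnconditional`, campaign «5Res (b) BL-2(χ,τ)»; dealer K2E1-plan (g6) deal (118) 2026-09-04T11:04:43Z
(SHEET (93)(b) row 12b, ED. 1 `…_of_letters`: the (χ,τ)-twin of ★ P8 §2 ∕ ★ `K2E1SphericalEisensteinMeromorphicBallOfLtU` with a VECTOR constant-term parameter, over ★ row 11b).
-/
import Summits.HodgeConjecture.HodgeConjecture.Theorems.K2E1SphericalEisensteinMeromorphicBallU2   -- ★ P8 §2 (K2E3-p12): `exists_meromorphicOn_scalar_of_system'`, `piN_comp_restrHN_comp_iota`, `isCompactOperator_deltaShift_comp_one_sub_cnstN`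
import Summits.HodgeConjecture.HodgeConjecture.Theorems.K2E1BLXSystemPackageFinDimU               -- ★ p859598 (this seat) row 11b: `exists_xSystem_finDim`, `xSystem_existsUnique_of_finDim`
import HarnessLib

/-!
# h413 ∕ Track B «K2-LIT», campaign «5Res (b) BL-2(χ,τ)» — `K2E1ChiEisensteinMeromorphicBallU2` (SHEET row 12b, ED. 1 `…_of_letters`): BERNSTEIN–LAPID ON ONE BALL FOR A SECTION `φ` WITH A
# FINITE-DIMENSIONAL CONSTANT-TERM PARAMETER — the `hball n g` clause `∃ Ec, MeromorphicOn Ec (ball 0 (n+2)) ∧ Ec = E(f_z^φ)(g) on the Godement part` from the letters, every rank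

Cell `pub/hodgecm-mathlib`, crux h413 = `stmt-HodgeConjecture-24833`, route of record `HCCMUnconditional`; chair K2-lead (g1), dealer K2E1-plan (g6) deals (112)∕(118), rulings (119)(2)–(3)
(12c road: arch-only test functions act on `V = chiSectionSpace χ K′ ω` by SCALARS `𝔥_h(z) = s(z)·id_V`, so for each fixed `φ ∈ V` the (χ,τ) ball system keeps the SCALAR Hecke clause
`T_i ψ = ĥ_i(z)·ψ` of ★ P8 §2 and only the constant-term line `ℂ·[H^{ρ₀−z}]` becomes the finite-dimensional space `V′_{ρ₀−z}` of ★ row 11b).  THEOREMS ONLY (no `def`, no `instance`, no notation,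
no named-fact hypothesis, no `sorry`); lane `--supports stmt-HodgeConjecture-24833 --as helper` (count-neutral).  Closes no socket.  Rank-generic `(F, E, c, N)`.

WHAT CHANGES W.R.T. ★ `sphericalEisenstein_meromorphicOn_ball_of_letters_of_lt` (p859301): (a) the first constant-term vector `α₁ z` (= `[f_z^φ]`) is a LETTER with its holomorphy `hα₁d` on the
ball (for `φ ≡ φ₀` ★ `differentiableOn_HN_of_ae_eq_cpow_self` pays it; for a bounded continuous χ-section the (χ,τ) chain pays it); (b) the second exponent enters through a holomorphic family
`L : ℂ → (B →L 𝓗_k(Z_a))` on a finite-dimensional normed `B` (coordinates of `V′`; `L(z)b = Σ_j b_j·[f^{φ′_j}_{ρ₀−z}]`), the unknown is `(ψ, b) ∈ 𝓗_k(𝔛) × B`, the constant-term letter is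
`hsolC : cnstN(ι(eX z)) = φ₀·α₁ z + L z (bX z)`, and the non-degeneracy letter `α₂ z ≠ 0` is `hLinj : L z` INJECTIVE on the Godement part of the ball; (c) the Eisenstein series is
`E(f_z^φ) = eisensteinSeriesU (flatSectionU φ z)` for an ARBITRARY section `φ`, tied to the unknown only through `hΛ : Λ(eX z) = ĥ_{i₀}(z)·E(f_z^φ)(g)` (row 10 ★ p859566 at a test function
acting by the scalar `ĥ_{i₀}`).  Engine: ★ row 11b `exists_xSystem_finDim` ∕ `xSystem_existsUnique_of_finDim` + ★ P8 §2's `exists_meromorphicOn_scalar_of_system'` (`O := {σ₀ < re}`) VERBATIM.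

* **`chiEisenstein_meromorphicOn_ball_of_letters`** — `∃ Ec : ℂ → ℂ` meromorphic on `ball 0 (n + 2)` with `Ec z = E(f_z^φ)(g)` for `z` in the ball with `σ₀ < Re z`.
* **`chiEisenstein_meromorphic_solution_of_letters`** — the VECTOR form: the packaged system `(A, c)` of ★ row 11b with its solution characterisation, and `v : ℂ → 𝓗_k(𝔛) × B` MEROMORPHIC on
  the ball, eventually near every point THE unique solution (★ `exists_meromorphic_solution_eventually`) — the source of X1_χ's `vX ∕ bX` (rows 13–15).

HONEST LABEL: HC_CM is proved only modulo the 7 printed citations (2 remaining named inputs: hLiu418 = `stmt-HodgeConjecture-24832`, h413 = `stmt-HodgeConjecture-24833`) until rung 0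
closes; this file asserts no named fact and closes no socket.  NOT claimed: location of poles, functional equation, the Hom-valued (general Hecke-matrix) edition.
References: [BernsteinLapid2019] J. Bernstein, E. Lapid, *On the meromorphic continuation of Eisenstein series*, arXiv:1911.02342 (JAMS 37 (2024), doi:10.1090/jams/1020), Thm 2.3, §2.1,
§4 Claims 2–5 and p. 10; [MoeglinWaldspurger1995] C. Mœglin, J.-L. Waldspurger, *Spectral Decomposition and Eisenstein Series*, IV.1.8; [ReedSimonI1980] Thm. VI.13–VI.14.
-/

set_option autoImplicit false
-- the mandated namespace repeats `HodgeConjecture.HodgeConjecture`, as in every `Theorems/*.lean` of this sub-problem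
set_option linter.dupNamespace false

noncomputable section

open MeasureTheory Filter Topology Set Submodule NumberField
open scoped NNReal ENNReal Classical
open Literature.NumberTheory.Automorphic Literature.NumberTheory.Automorphic.UnitaryGroup AdelicGroupData
open Summit.HodgeConjecture.HodgeConjecture.Cruxes.H413.K2E1BorelEisensteinU
open Summit.HodgeConjecture.HodgeConjecture.Cruxes.H413.K2E1BLBorelSpacesU2Defs
open Summit.HodgeConjecture.HodgeConjecture.Cruxes.H413.K2E1BLBorelOperatorsU2Defs
open Summit.HodgeConjecture.HodgeConjecture.Cruxes.H413.K2E1SphericalHeckeEigenSectionU2 (differentiable_integral_mul_borelHeight_cpow)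
open Summit.HodgeConjecture.HodgeConjecture.Cruxes.H413.K2E1BLSystemAssembly (exists_meromorphic_solution_eventually)
open Summit.HodgeConjecture.HodgeConjecture.Cruxes.H413.K2E1BLXSystemPackageFinDimU (exists_xSystem_finDim xSystem_existsUnique_of_finDim)
open Summit.HodgeConjecture.HodgeConjecture.Cruxes.H413.K2E1SphericalEisensteinMeromorphicBallU2 (exists_meromorphicOn_scalar_of_system' piN_comp_restrHN_comp_iota
  isCompactOperator_deltaShift_comp_one_sub_cnstN)

namespace Summit.HodgeConjecture.HodgeConjecture.Cruxes.H413.K2E1ChiEisensteinMeromorphicBallU2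

variable {F E : Type} [Field F] [NumberField F] [Field E] [NumberField E] [Algebra F E] {c : E ≃ₐ[F] E} {N : ℕ} [NeZero N]
variable [MeasurableSpace (quasiSplit F E c N).Adelic] [BorelSpace (quasiSplit F E c N).Adelic]

/-- **THE (χ,τ) BALL SYSTEM, VECTOR FORM** [BernsteinLapid2019, Thm 2.3, §4 Claims 2–5 and p. 10]: from the letters of ★ P8 §2 with a finite-dimensional constant-term parameter `B` (module
docstring) — levels and ι-package, good test functions `h i` with `ĥ_i` having no common zero on the ball, `ShiftBound` and K2 decay letters, the `𝔛`-side Hecke operators with the intertwining,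
the holomorphic constant-term data `α₁`, `L` on the ball, a cusp-orthogonality operator `Q`, the Eisenstein data `(eX, bX)` solving the three conditions on the Godement part `{σ₀ < Re z}`, `L z`
injective there, and uniqueness of the `ψ`-component on an open non-empty `U₀` — THEN the packaged system `A z (ψ, b) = c z` of ★ row 11b (holomorphic on the ball, characterised by the three
conditions) has a solution family `v : ℂ → 𝓗_k(𝔛) × B` MEROMORPHIC on the ball which is, in a punctured neighbourhood of EVERY point of the ball, THE unique solution (★ `exists_meromorphic_solution_eventually`).
[cite: BernsteinLapid2019, Thm 2.3, §4 Claims 2–5 and p. 10] [cite: ReedSimonI1980, Thm. VI.14] -/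
theorem chiEisenstein_meromorphic_solution_of_letters (σ₀ : ℝ) (n k : ℕ) {μ : Measure (quasiSplit F E c N).automorphicQuotient}
    {μZ : Measure (borelQuotient F E c N)} (νG : Measure (quasiSplit F E c N).Adelic) [IsFiniteMeasureOnCompacts νG]
    -- levels and the ι-package
    {I : Type} [Fintype I] {a : ℝ≥0} (ha : 0 < a) {a₀ : I → ℝ≥0} (haa₀ : ∀ i, a ≤ a₀ i)
    [hfin₀ : ∀ i, IsFiniteMeasure (weightedTruncMeasure F E c N k (a₀ i) μZ)] (hb : IotaBound F E c N k a μ μZ) (hb₀ : ∀ i, IotaBound F E c N k (a₀ i) μ μZ)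
    (hcl₀ : ∀ i, IsClosed ((LinearMap.range (iota (hb₀ i)).toLinearMap : Submodule ℂ (HN F E c N k (a₀ i) μZ)) : Set (HN F E c N k (a₀ i) μZ)))
    (hinj₀ : ∀ i, Function.Injective (iota (hb₀ i)))
    -- the good test functions and their transforms
    (h : I → (quasiSplit F E c N).Adelic → ℂ) (hhc : ∀ i, Continuous (h i)) (hhs : ∀ i, HasCompactSupport (h i))
    (hcov : ∀ z ∈ Metric.ball (0 : ℂ) (n + 2), ∃ i, (∫ x, h i x * (((borelHeight x : ℝ≥0) : ℝ) : ℂ) ^ z ∂νG) ≠ 0)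
    -- the `Z`-side Hecke operators (★ `ShiftBound`) and K2's decay letters
    (hs : ∀ i, ShiftBound F E c N k a (a₀ i) νG μZ (h i)) {m C : I → ℝ} (hm : ∀ i, 0 ≤ m i) (hC : ∀ i, 0 ≤ C i)
    (hK1 : ∀ i, ∀ f : HNcusp F E c N k a μZ, ∀ᵐ z ∂(weightedTruncMeasure F E c N k (a₀ i) μZ),
      ‖rightConvFun F E c N νG (h i) ((f : HN F E c N k a μZ) : borelQuotient F E c N → ℂ) z‖ ≤ C i * ‖f‖ * ((borelQuotHeight F E c N z : ℝ)) ^ (-m i))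
    -- the `𝔛`-side Hecke operators and the intertwining (P3-C)
    (T : I → HX F E c N k μ →L[ℂ] HX F E c N k μ) (hδι : ∀ i, deltaShift (hs i) ∘L iota hb = restrHN F E c N k (haa₀ i) μZ ∘L iota hb ∘L T i)
    -- the constant-term data: `α₁` (`[f_z^φ]`) and the finite-dimensional family `L` (`b ↦ Σ_j b_j [f^{φ′_j}_{ρ₀−z}]`), both holomorphic on the ball; the cusp-orthogonality operator
    {α₁ : ℂ → HN F E c N k a μZ} (hα₁d : DifferentiableOn ℂ α₁ (Metric.ball (0 : ℂ) (n + 2)))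
    {B : Type*} [NormedAddCommGroup B] [NormedSpace ℂ B] [FiniteDimensional ℂ B] {L : ℂ → B →L[ℂ] HN F E c N k a μZ} (hL : DifferentiableOn ℂ L (Metric.ball (0 : ℂ) (n + 2)))
    (hLinj : ∀ z ∈ Metric.ball (0 : ℂ) (n + 2), σ₀ < z.re → Function.Injective (L z))
    {X' : Type} [NormedAddCommGroup X'] [NormedSpace ℂ X'] [CompleteSpace X'] (Q : HX F E c N k μ →L[ℂ] X') (φ₀ : ℂ)
    -- the Eisenstein data in `𝓗_k(𝔛) × B` on the Godement part of the ball
    (eX : ℂ → HX F E c N k μ) (bX : ℂ → B)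
    (hsolT : ∀ z ∈ Metric.ball (0 : ℂ) (n + 2), σ₀ < z.re → ∀ i, T i (eX z) = (∫ x, h i x * (((borelHeight x : ℝ≥0) : ℝ) : ℂ) ^ z ∂νG) • eX z)
    (hsolC : ∀ z ∈ Metric.ball (0 : ℂ) (n + 2), σ₀ < z.re → cnstN F E c N k a μZ (iota hb (eX z)) = φ₀ • α₁ z + L z (bX z))
    (hsolQ : ∀ z ∈ Metric.ball (0 : ℂ) (n + 2), σ₀ < z.re → Q (eX z) = 0)
    -- uniqueness of the `ψ`-component on an open non-empty part of the Godement set (row 12a's letter)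
    (hunq : ∃ U₀ : Set ℂ, IsOpen U₀ ∧ U₀.Nonempty ∧ U₀ ⊆ Metric.ball (0 : ℂ) (n + 2) ∩ {z : ℂ | σ₀ < z.re} ∧
      ∀ z ∈ U₀, ∀ (ψ : HX F E c N k μ) (b : B), (∀ i, T i ψ = (∫ x, h i x * (((borelHeight x : ℝ≥0) : ℝ) : ℂ) ^ z ∂νG) • ψ) →
        cnstN F E c N k a μZ (iota hb ψ) = φ₀ • α₁ z + L z b → Q ψ = 0 → ψ = eX z) :
    ∃ (A : ℂ → (HX F E c N k μ × B) →L[ℂ] (I → HX F E c N k μ) × (HN F E c N k a μZ × X')) (cc : ℂ → (I → HX F E c N k μ) × (HN F E c N k a μZ × X'))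
      (v : ℂ → HX F E c N k μ × B),
      (∀ (z : ℂ) (ψ : HX F E c N k μ) (b : B), A z (ψ, b) = cc z ↔
        (∀ i, T i ψ = (∫ x, h i x * (((borelHeight x : ℝ≥0) : ℝ) : ℂ) ^ z ∂νG) • ψ) ∧ cnstN F E c N k a μZ (iota hb ψ) = φ₀ • α₁ z + L z b ∧ Q ψ = 0) ∧
      (∀ z ∈ Metric.ball (0 : ℂ) (n + 2), σ₀ < z.re → A z (eX z, bX z) = cc z) ∧
      MeromorphicOn v (Metric.ball (0 : ℂ) (n + 2)) ∧
      ∀ z₀ ∈ Metric.ball (0 : ℂ) (n + 2), ∀ᶠ z in 𝓝[≠] z₀, ∀ w : HX F E c N k μ × B, A z w = cc z ↔ w = v z := by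
  haveI : CompleteSpace B := FiniteDimensional.complete ℂ B
  have hD : IsOpen (Metric.ball (0 : ℂ) (n + 2)) := Metric.isOpen_ball
  have hDc : IsPreconnected (Metric.ball (0 : ℂ) (n + 2)) := (convex_ball (0 : ℂ) _).isPreconnected
  -- holomorphy of the transforms
  have hĥ : ∀ i, DifferentiableOn ℂ (fun z : ℂ => ∫ x, h i x * (((borelHeight x : ℝ≥0) : ℝ) : ℂ) ^ z ∂νG) (Metric.ball (0 : ℂ) (n + 2)) := fun i =>
    (differentiable_integral_mul_borelHeight_cpow νG (hhc i) (hhs i)).differentiableOn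
  -- the packaged `𝔛`-system with a finite-dimensional parameter (★ row 11b) over the concrete letters
  haveI : CompleteSpace ((I → HX F E c N k μ) × (HN F E c N k a μZ × X')) := inferInstance
  obtain ⟨A, cc, hA, hcc, hchar, hfinT⟩ := exists_xSystem_finDim (V₀ := fun i => HN F E c N k (a₀ i) μZ) hD T hĥ hcov (iota hb) (cnstN F E c N k a μZ) Q hα₁d hL φ₀
    (fun i => deltaShift (hs i)) (fun i => restrHN F E c N k (haa₀ i) μZ) (fun i => piN (hb₀ i) (hcl₀ i) (hinj₀ i)) hδι
    (fun i => piN_comp_restrHN_comp_iota (haa₀ i) hb (hb₀ i) (hcl₀ i) (hinj₀ i))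
    (fun i => isCompactOperator_deltaShift_comp_one_sub_cnstN (lt_of_lt_of_le ha (haa₀ i)) (hs i) (hm i) (hC i) (hK1 i))
  -- existence on the Godement set, uniqueness on `U₀`
  have hsol : ∀ z ∈ Metric.ball (0 : ℂ) (n + 2) ∩ {z : ℂ | σ₀ < z.re}, A z (eX z, bX z) = cc z := fun z hz =>
    (hchar z (eX z) (bX z)).2 ⟨hsolT z hz.1 hz.2, hsolC z hz.1 hz.2, hsolQ z hz.1 hz.2⟩
  obtain ⟨U₀, hU₀o, hU₀ne, hU₀D, hU₀unq⟩ := hunq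
  have hunq' : ∃ U₀ : Set ℂ, IsOpen U₀ ∧ U₀.Nonempty ∧ U₀ ⊆ Metric.ball (0 : ℂ) (n + 2) ∧ ∀ z ∈ U₀, ∃! x : HX F E c N k μ × B, A z x = cc z := by
    refine ⟨U₀, hU₀o, hU₀ne, fun z hz => (hU₀D hz).1, fun z hz => ?_⟩
    exact xSystem_existsUnique_of_finDim hchar (hLinj z (hU₀D hz).1 (hU₀D hz).2) (hsol z (hU₀D hz)) fun ψ b hψb =>
      hU₀unq z hz ψ b ((hchar z ψ b).1 hψb).1 ((hchar z ψ b).1 hψb).2.1 ((hchar z ψ b).1 hψb).2.2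
  obtain ⟨v, hv, hev⟩ := exists_meromorphic_solution_eventually hD hDc hA hcc hfinT hunq'
  exact ⟨A, cc, v, hchar, fun z hz hz1 => hsol z ⟨hz, hz1⟩, hv, hev⟩

/-- **BERNSTEIN–LAPID ON ONE BALL FOR A SECTION `φ`, LETTERS HYPOTHESIS-FIRST** [BernsteinLapid2019, §4 Claims 3–5 and p. 10, with Thm 2.3 and §2.1]: from the letters of the vector form and, in
addition, `i₀ ∈ I` with `ĥ_{i₀} ≢ 0` on the ball and a functional `Λ` with `Λ(eX z) = ĥ_{i₀}(z)·E(f_z^φ)(g)` on the Godement part (row 10 at a test function acting by a scalar), THEN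
`∃ Ec : ℂ → ℂ` meromorphic on `ball 0 (n + 2)` with `Ec z = E(f_z^φ)(g)` for `z` in the ball with `σ₀ < Re z` — the `hball n g` clause for the (χ,τ) Eisenstein series of an ARBITRARY section
`φ`.  ★ row 11b `exists_xSystem_finDim` ∕ `xSystem_existsUnique_of_finDim` + ★ `exists_meromorphicOn_scalar_of_system'` (`O := {σ₀ < re}`), the proof of ★ `…_of_letters_of_lt` line by line.
[cite: BernsteinLapid2019, §4 Claims 3–5 and p. 10] [cite: MoeglinWaldspurger1995, IV.1.8] -/
theorem chiEisenstein_meromorphicOn_ball_of_letters (σ₀ : ℝ) (n k : ℕ) {μ : Measure (quasiSplit F E c N).automorphicQuotient}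
    {μZ : Measure (borelQuotient F E c N)} (νG : Measure (quasiSplit F E c N).Adelic) [IsFiniteMeasureOnCompacts νG]
    {I : Type} [Fintype I] (i₀ : I) {a : ℝ≥0} (ha : 0 < a) {a₀ : I → ℝ≥0} (haa₀ : ∀ i, a ≤ a₀ i)
    [hfin₀ : ∀ i, IsFiniteMeasure (weightedTruncMeasure F E c N k (a₀ i) μZ)] (hb : IotaBound F E c N k a μ μZ) (hb₀ : ∀ i, IotaBound F E c N k (a₀ i) μ μZ)
    (hcl₀ : ∀ i, IsClosed ((LinearMap.range (iota (hb₀ i)).toLinearMap : Submodule ℂ (HN F E c N k (a₀ i) μZ)) : Set (HN F E c N k (a₀ i) μZ)))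
    (hinj₀ : ∀ i, Function.Injective (iota (hb₀ i)))
    (h : I → (quasiSplit F E c N).Adelic → ℂ) (hhc : ∀ i, Continuous (h i)) (hhs : ∀ i, HasCompactSupport (h i))
    (hcov : ∀ z ∈ Metric.ball (0 : ℂ) (n + 2), ∃ i, (∫ x, h i x * (((borelHeight x : ℝ≥0) : ℝ) : ℂ) ^ z ∂νG) ≠ 0)
    (hĥ₀ : ∃ z ∈ Metric.ball (0 : ℂ) (n + 2), (∫ x, h i₀ x * (((borelHeight x : ℝ≥0) : ℝ) : ℂ) ^ z ∂νG) ≠ 0)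
    (hs : ∀ i, ShiftBound F E c N k a (a₀ i) νG μZ (h i)) {m C : I → ℝ} (hm : ∀ i, 0 ≤ m i) (hC : ∀ i, 0 ≤ C i)
    (hK1 : ∀ i, ∀ f : HNcusp F E c N k a μZ, ∀ᵐ z ∂(weightedTruncMeasure F E c N k (a₀ i) μZ),
      ‖rightConvFun F E c N νG (h i) ((f : HN F E c N k a μZ) : borelQuotient F E c N → ℂ) z‖ ≤ C i * ‖f‖ * ((borelQuotHeight F E c N z : ℝ)) ^ (-m i))
    (T : I → HX F E c N k μ →L[ℂ] HX F E c N k μ) (hδι : ∀ i, deltaShift (hs i) ∘L iota hb = restrHN F E c N k (haa₀ i) μZ ∘L iota hb ∘L T i)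
    {α₁ : ℂ → HN F E c N k a μZ} (hα₁d : DifferentiableOn ℂ α₁ (Metric.ball (0 : ℂ) (n + 2)))
    {B : Type*} [NormedAddCommGroup B] [NormedSpace ℂ B] [FiniteDimensional ℂ B] {L : ℂ → B →L[ℂ] HN F E c N k a μZ} (hL : DifferentiableOn ℂ L (Metric.ball (0 : ℂ) (n + 2)))
    (hLinj : ∀ z ∈ Metric.ball (0 : ℂ) (n + 2), σ₀ < z.re → Function.Injective (L z))
    {X' : Type} [NormedAddCommGroup X'] [NormedSpace ℂ X'] [CompleteSpace X'] (Q : HX F E c N k μ →L[ℂ] X') (φ₀ : ℂ) (φ : (quasiSplit F E c N).Adelic → ℂ)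
    (eX : ℂ → HX F E c N k μ) (bX : ℂ → B)
    (hsolT : ∀ z ∈ Metric.ball (0 : ℂ) (n + 2), σ₀ < z.re → ∀ i, T i (eX z) = (∫ x, h i x * (((borelHeight x : ℝ≥0) : ℝ) : ℂ) ^ z ∂νG) • eX z)
    (hsolC : ∀ z ∈ Metric.ball (0 : ℂ) (n + 2), σ₀ < z.re → cnstN F E c N k a μZ (iota hb (eX z)) = φ₀ • α₁ z + L z (bX z))
    (hsolQ : ∀ z ∈ Metric.ball (0 : ℂ) (n + 2), σ₀ < z.re → Q (eX z) = 0)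
    (hunq : ∃ U₀ : Set ℂ, IsOpen U₀ ∧ U₀.Nonempty ∧ U₀ ⊆ Metric.ball (0 : ℂ) (n + 2) ∩ {z : ℂ | σ₀ < z.re} ∧
      ∀ z ∈ U₀, ∀ (ψ : HX F E c N k μ) (b : B), (∀ i, T i ψ = (∫ x, h i x * (((borelHeight x : ℝ≥0) : ℝ) : ℂ) ^ z ∂νG) • ψ) →
        cnstN F E c N k a μZ (iota hb ψ) = φ₀ • α₁ z + L z b → Q ψ = 0 → ψ = eX z)
    -- the evaluation functional after the test function `h i₀` at `g` (row 10 ∕ P3-D), for the Eisenstein series of the section `φ`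
    (g : (quasiSplit F E c N).Adelic) (Λ : HX F E c N k μ →L[ℂ] ℂ)
    (hΛ : ∀ z ∈ Metric.ball (0 : ℂ) (n + 2), σ₀ < z.re →
      Λ (eX z) = (∫ x, h i₀ x * (((borelHeight x : ℝ≥0) : ℝ) : ℂ) ^ z ∂νG) * eisensteinSeriesU (flatSectionU φ z) g) :
    ∃ Ec : ℂ → ℂ, MeromorphicOn Ec (Metric.ball (0 : ℂ) (n + 2)) ∧
      ∀ z ∈ Metric.ball (0 : ℂ) (n + 2), σ₀ < z.re → Ec z = eisensteinSeriesU (flatSectionU φ z) g := by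
  haveI : CompleteSpace B := FiniteDimensional.complete ℂ B
  have hD : IsOpen (Metric.ball (0 : ℂ) (n + 2)) := Metric.isOpen_ball
  have hDc : IsPreconnected (Metric.ball (0 : ℂ) (n + 2)) := (convex_ball (0 : ℂ) _).isPreconnected
  have hĥ : ∀ i, DifferentiableOn ℂ (fun z : ℂ => ∫ x, h i x * (((borelHeight x : ℝ≥0) : ℝ) : ℂ) ^ z ∂νG) (Metric.ball (0 : ℂ) (n + 2)) := fun i =>
    (differentiable_integral_mul_borelHeight_cpow νG (hhc i) (hhs i)).differentiableOn
  -- the packaged `𝔛`-system (★ row 11b) over the concrete letters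
  haveI : CompleteSpace ((I → HX F E c N k μ) × (HN F E c N k a μZ × X')) := inferInstance
  obtain ⟨A, cc, hA, hcc, hchar, hfinT⟩ := exists_xSystem_finDim (V₀ := fun i => HN F E c N k (a₀ i) μZ) hD T hĥ hcov (iota hb) (cnstN F E c N k a μZ) Q hα₁d hL φ₀
    (fun i => deltaShift (hs i)) (fun i => restrHN F E c N k (haa₀ i) μZ) (fun i => piN (hb₀ i) (hcl₀ i) (hinj₀ i)) hδι
    (fun i => piN_comp_restrHN_comp_iota (haa₀ i) hb (hb₀ i) (hcl₀ i) (hinj₀ i))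
    (fun i => isCompactOperator_deltaShift_comp_one_sub_cnstN (lt_of_lt_of_le ha (haa₀ i)) (hs i) (hm i) (hC i) (hK1 i))
  -- existence on the Godement set, uniqueness on `U₀`, the functional identity; assemble
  have hsol : ∀ z ∈ Metric.ball (0 : ℂ) (n + 2) ∩ {z : ℂ | σ₀ < z.re}, A z (eX z, bX z) = cc z := fun z hz =>
    (hchar z (eX z) (bX z)).2 ⟨hsolT z hz.1 hz.2, hsolC z hz.1 hz.2, hsolQ z hz.1 hz.2⟩
  obtain ⟨U₀, hU₀o, hU₀ne, hU₀D, hU₀unq⟩ := hunq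
  have hunq' : ∃ U₀ : Set ℂ, IsOpen U₀ ∧ U₀.Nonempty ∧ U₀ ⊆ Metric.ball (0 : ℂ) (n + 2) ∩ {z : ℂ | σ₀ < z.re} ∧
      ∀ z ∈ U₀, ∀ w : HX F E c N k μ × B, A z w = cc z → w = (eX z, bX z) := by
    refine ⟨U₀, hU₀o, hU₀ne, hU₀D, fun z hz w hw => ?_⟩
    have hex : ∃! x : HX F E c N k μ × B, A z x = cc z :=
      xSystem_existsUnique_of_finDim hchar (hLinj z (hU₀D hz).1 (hU₀D hz).2) (hsol z (hU₀D hz)) fun ψ b hψb =>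
        hU₀unq z hz ψ b ((hchar z ψ b).1 hψb).1 ((hchar z ψ b).1 hψb).2.1 ((hchar z ψ b).1 hψb).2.2
    exact hex.unique hw (hsol z (hU₀D hz))
  have hΛ' : ∀ z ∈ Metric.ball (0 : ℂ) (n + 2) ∩ {z : ℂ | σ₀ < z.re}, (Λ ∘L ContinuousLinearMap.fst ℂ (HX F E c N k μ) B) (eX z, bX z) =
      (∫ x, h i₀ x * (((borelHeight x : ℝ≥0) : ℝ) : ℂ) ^ z ∂νG) * eisensteinSeriesU (flatSectionU φ z) g := fun z hz => by
    show Λ (eX z) = _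
    exact hΛ z hz.1 hz.2
  obtain ⟨Ec, hEc, hEcE⟩ := exists_meromorphicOn_scalar_of_system' (O := {z : ℂ | σ₀ < z.re})
    (E := fun z => eisensteinSeriesU (flatSectionU φ z) g) hD hDc hA hcc hfinT (hĥ i₀) hĥ₀ hsol hunq'
    (Λ ∘L ContinuousLinearMap.fst ℂ (HX F E c N k μ) B) hΛ'
  exact ⟨Ec, hEc, fun z _ hz1 => hEcE z hz1⟩

end Summit.HodgeConjecture.HodgeConjecture.Cruxes.H413.K2E1ChiEisensteinMeromorphicBallU2

end
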